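import Summits.BirchSwinnertonDyer.BirchSwinnertonDyer.Theorems.KimAtThreeTwoExponentWitnessPairU
import Summits.BirchSwinnertonDyer.BirchSwinnertonDyer.Theorems.KimAtThreeShallowEqDeepPortNonAddFineKato
import HarnessLib

/-!
# Route `KimAtThreeKolyvagin` (W2): the TWO-EXPONENT unlocked Kato–Kurihara port on the NON-ADDITIVE
# non-anomalous `t = 0` rows — the SPLIT-MULTIPLICATIVE `3 ∣ c₃` rows INCLUDED — from Kato's Euler system
# (`ZetaBody` on the `3`-scaled body) and from the fine Kato package (C1′₂) alone; the shallow = deep / leaf /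
# lower row conclusions of cruxes 19599 / 19077 / 19679 there

Cell `bsd-addord`, seat `bsd-addord-w2-c4` (gen 10; owner of crux 19599 `ShallowEqDeepOffKatoStratum`, item
19077 `ShallowEqDeepAtTorsionFree`).  `--supports` 19599.  HONEST FRAMING: END-TYPE TOOL THEOREMS WITH
DISPLAYED HYPOTHESES (no definition, no named fact, no instance, no `sorry`); nothing asserted about any
curve, nothing booked; 19560 / 19599 / 19077 / 19679 stay OPEN; BSD is not proved by any of this.  Credit:
★ PK-6₂ is team n1011's; the two-exponent currency and ★₂ are seat acc6's (gen 0/2); ★★-u (the `hbad`-free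
two-exponent witness pair on seat w2-c3's THEOREM D-u) is seat acc3's (gen 3, `KimAtThreeTwoExponentWitnessPairU`);
the `3`-scaled zeta body, its value rows and the certificate supply on the non-additive rows are this seat's gen 8
(`KimAtThreeShallowEqDeepZetaBodyScaling` / `…ValueRowsNonAdd` / `…CertSupplyNonAdd`); this gen only re-keys.

## Why (the one non-additive row type that had no port-from-package theorem)

Gens 8–9 discharged the unlocked port at `e = 0` on the good rows (anomalous included, (C1_τ)) and on the
multiplicative rows with `3 ∤ c₃` ((C1′), rider at exponent `1`).  On a SPLIT-multiplicative row with
`3^v ∥ c₃`, `v ≥ 1`, `E(ℚ₃)[3] = 0` (possible: the unit part of the Tate parameter is not a cube), the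
dual-exponential lattice at the base is `exp*_ω(H¹(ℚ₃,T)) = 3^{v−1}ℤ₃` (Tate curve: `log_ω(E(ℚ₃)⊗ℤ₃) =
3^{1−v}ℤ₃` since `[E(ℚ₃):E₀(ℚ₃)] = c₃` and `log_ω E₀(ℚ₃) = 3ℤ₃`), so the primitive finite-level functional is
`Λfin = exp*/3^{v−1}` and the scalar compatibility of the rider holds with the DEFECT EXPONENT `e = v`:
`3•Λ(y) ≡ s (mod 3^{j+1}L_int)  ⟹  3^e·Λfin(loc κ₀) = s̄` — the two-exponent rider RIDER₂ at `(1, e)` (own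
check, memo HOME/w2c4/W2C4-MULT-TWOEXP-g10.md §2: at an unramified level `K` the semi-local log lattice is
`3𝓞_K + 3^{1−v}ℤ₃·N_G·ξ`, its trace dual is `M_K = {m ∈ 3⁻¹𝓞_K : Tr m ∈ 3^{v−1}ℤ₃}`, and
`(3^{j+1}𝓞_K + 3^{j+2}M_K) ∩ ℚ₃ = 3^{j+1}ℤ₃`, so no digit is lost; at a non-split multiplicative `3` the same
holds with `e = 0` at every level).  The value rows do not see `c₃`: they are gen 8's rows of the `3`-SCALED
zeta body under the NON-ANOMALOUS depletion certificate (`q = 3` factor `3 − a₃ ∈ {2, 4}` at a multiplicative `3`).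

## What

* §1 `rider₂_smul` — RIDER₂ at `(t+1, e)` for `Λ` is RIDER₂ at `(t, e)` for `3 • Λ` (gen 8's
  `katoExpStarFiniteLevelAt_smul` in the two-exponent currency).
* §2 `katoKuriharaPortUnlockedTwoExp_zero_of_zetaBody_of_unramified` — ★₂-u UNLOCKED: the bare two-depth
  witness clauses `KatoKuriharaWitnessAtTwoExp W · 0 e · v₃ P` + (COMP) from `hbody`, the (Λ)-clauses, the
  riders RIDER₂ at `(0, e)`, `hcdA`, `ht0`, the value rows (displayed), surj(3), `v₃` — ANY reduction type at `3`
  (acc3's ★₂-u with the locked predicate's antecedents `Addv` / surj / `t` moved out; proof text adapted).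
* §3 `katoKuriharaPortUnlockedTwoExp_zero_of_zetaBody_nonAdd_of_unramified` — §2 on the `3`-scaled body
  `zetaBody_smul 3 hbody`: the unlocked two-exponent port on the NON-ADDITIVE non-anomalous `t = 0` rows from
  `hbody` + R-κ + guards + the non-anomalous depletion certificate + the 𝔊⁻ certificate + the (Λ)-clauses +
  RIDER₂ at `(1, e)` + `hcdA` + `ht0`.
* §4 `portUnlockedTwoExp_of_fineKato₁₂_of_nonanomalous` — the same from surj(3) ∧ `#E(ℚ₃)[3] = 1` ∧ the
  non-anomaly certificate `3 ∤ 3 + 𝟙_{3∤N} − a₃` ∧ **(C1′₂)** ALONE, (C1′₂) := Kato's `ZetaBody` family for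
  `P.f` at the conductor with R-κ, the (Λ)-clauses and the two-exponent riders RIDER₂ at `(1, e)` for ONE `e`
  (certificates by `certSupply_row_nonAdd`, `ht0` by transport `ℚ_[3] ≃ ℚ_w`, instance binders inside).
* §5 `shallowEqDeep_row_…` / `leaf_row_…` / `lower_row_of_fineKato₁₂_of_nonanomalous` — 19599 / 19077's
  conclusion, the LEAF row and 19679 / 19075's conclusion AT such a tower row with the datum at the conductor
  ⟸ [S24] (1)(2) ∧ GZK ∧ PT ∧ tower ∧ `#E(ℚ₃)[3] = 1` ∧ `3`-integral plus symbols ∧ `ord(δ̃) = 0` ∧ `v₃` ∧ `η`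
  ∧ non-anomaly ∧ (C1′₂) (gen 7 PortRows at exponent `e`).

READING (08-28 residual): every MULTIPLICATIVE `t = 0` tower row of 19599 / 19077 / 19679 (split with `3 ∣ c₃`
included) rests on PUB + ONE displayed construction object (C1′₂) = crux 19560's debt class (C1) with the
rider read at exponent `1` and the dictionary at defect exponent `e` (`e = v₃(c₃)` in truth; `e` is free in
the package, it cancels in the END argument).  HONEST LIMITS: `t = 0` only; (C1′₂) / non-anomaly displayed;
good ANOMALOUS rows are gen 9's (C1_τ) (not re-done here); nothing booked.

References: [Kato2004Asterisque] (8.1.3) p. 180, §9.4, Thm. 9.7 p. 189, §6.2, Thm. 6.6 (1) p. 163, Ex. 13.3;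
[Kim2022StructureSelmer] §3.2.3, Lemma 3.3, Thm. 3.6, Thm. 3.13, Thm. 1.9 (6); [Kim2025RefinedTNC] Thm 1.1/1.2,
§8.1.2; [MazurRubin2004] Def. 3.1.3, Thm. 3.2.4, 4.4.1, 5.2.12, App. A (Lemma A.1, Remark A.5); [Sakamoto2024]
§2, Def. 4.1, Thm. 4.4; [Silverman2009AEC] C.14–C.15 (Tate curve); memo HOME/w2c4/W2C4-MULT-TWOEXP-g10.md.
-/

set_option autoImplicit false
-- the Theorems namespace of a single-conjunct summit repeats the summit name by design (D-0017)
set_option linter.dupNamespace false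

noncomputable section

open scoped NumberField TensorProduct ContRepresentation Classical
open CategoryTheory Field Function Finset IsDedekindDomain NumberField WeierstrassCurve
open Rat.HeightOneSpectrum
open Literature.NumberTheory.GaloisRepresentations Literature.NumberTheory.GaloisCohomology
open Literature.NumberTheory.GaloisRepresentations.DiscreteGaloisModule
open Literature.NumberTheory.EllipticCurves Literature.NumberTheory.EllipticCurves.ModularForms
open Literature.NumberTheory.EllipticCurves.Rank1Residual
open Literature.NumberTheory.EllipticCurves.Kato2004
open Literature.NumberTheory.EllipticCurves.Kato2004.EulerSystemValues
open Summit.BirchSwinnertonDyer.Rank1Residual.GaloisImage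
open Summit.BirchSwinnertonDyer.BirchSwinnertonDyer.Theorems
open Summit.BirchSwinnertonDyer.BirchSwinnertonDyer.Theorems.KimAtThreeKolyvaginDefs
open Summit.BirchSwinnertonDyer.BirchSwinnertonDyer.Theorems.KimAtThreeShallowEqDeepZetaBodyScaling
open Summit.BirchSwinnertonDyer.BirchSwinnertonDyer.Theorems.KimAtThreeShallowEqDeepValueRowsNonAdd
open Summit.BirchSwinnertonDyer.BirchSwinnertonDyer.Theorems.KimAtThreeShallowEqDeepCertSupplyNonAdd

namespace Summit.BirchSwinnertonDyer.BirchSwinnertonDyer.Theorems.KimAtThreeShallowEqDeepMultTwoExpPort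

/-- Local notation: `𝐃F⟦r, τ⟧ ℓ = Σ_{j<ℓ−1} j·σ_{χ_{m(0,r)}(τ_ℓ)}^j` on the level field `ℚ(ζ_{m(0,r)})`. -/
local notation3 (prettyPrint := false) "𝐃F⟦" r ", " τ "⟧" =>
  fun ℓ : HeightOneSpectrum (𝓞 ℚ) =>
  ∑ j ∈ Finset.range (((primesEquiv ℓ : Nat.Primes) : ℕ) - 1),
    (j : Module.End ℚ (CyclotomicField (cycLevel 3 0 r) ℚ)) *
      (sigma (cycLevel 3 0 r) (modNCyclotomicCharacter ℚ (cycLevel 3 0 r)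
          ((τ : HeightOneSpectrum (𝓞 ℚ) → absoluteGaloisGroup ℚ) ℓ)) :
        CyclotomicField (cycLevel 3 0 r) ℚ →ₐ[ℚ] CyclotomicField (cycLevel 3 0 r) ℚ).toLinearMap ^ j

/-- Local notation: the TWO-EXPONENT rider clause (ii₂) at depth `j`, torsion slot `t`, defect exponent `e`,
place `v`, for the pair `(Λ, Λf)` (seat acc6's RIDER₂, VERBATIM). -/
local notation3 (prettyPrint := false) "RIDER₂⟦" W' ", " j ", " t' ", " e' ", " v' ", " Λ' ", " Λf "⟧" =>
  ∀ (r : Finset (HeightOneSpectrum (𝓞 ℚ)))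
    (Ψ : H1 (tateRep W' 3) (cycSubgroup 3 0 r) →+
      continuousCohomology 1
        (subgroupRep (WeierstrassCurve.torsionGaloisModule W' (((3 : ℕ) : ℤ) ^ j * ((3 : ℕ) : ℤ))).toTopRep
          (cycSubgroup 3 0 r))),
    (∀ (φ : contOneCocycles (subgroupRep (tateRep W' 3).toTopRep (cycSubgroup 3 0 r)))
        (ψ : contOneCocycles
          (subgroupRep (WeierstrassCurve.torsionGaloisModule W' (((3 : ℕ) : ℤ) ^ j * ((3 : ℕ) : ℤ))).toTopRep
            (cycSubgroup 3 0 r))),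
        (∀ g, ((ψ.1 g : geomTorsion W' (((3 : ℕ) : ℤ) ^ j * ((3 : ℕ) : ℤ))) : geomPoints W') =
          TateModule.proj 3 (j + 1) (φ.1 g)) →
        Ψ (oneCocycleClass _ φ) = oneCocycleClass _ ψ) →
    ∀ (y : H1 (tateRep W' 3) (cycSubgroup 3 0 r))
      (κ₀ : galoisCohomology (WeierstrassCurve.torsionGaloisModule W' (((3 : ℕ) : ℤ) ^ j * ((3 : ℕ) : ℤ))) 1)
      (s : ℤ_[3]),
      resSubgroup (WeierstrassCurve.torsionGaloisModule W' (((3 : ℕ) : ℤ) ^ j * ((3 : ℕ) : ℤ))).toTopRep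
          (cycSubgroup 3 0 r) 1 κ₀ = Ψ y →
      galoisCohomology.localization (WeierstrassCurve.torsionGaloisModule W' (((3 : ℕ) : ℤ) ^ j * ((3 : ℕ) : ℤ)))
          (Sum.inr v') 1 κ₀ ∈ propagatedSelmerStructure W' 3 j (Sum.inr v') →
      (∃ l ∈ cycIntLattice 3 (cycLevel 3 0 r),
          (((3 : ℕ) : ℤ_[3]) ^ t') • Λ' 0 r y - ((s : ℚ_[3]) ⊗ₜ[ℚ] (1 : CyclotomicField (cycLevel 3 0 r) ℚ)) =
            (((3 : ℕ) : ℤ_[3]) ^ (j + 1)) • (l : ℚ_[3] ⊗[ℚ] CyclotomicField (cycLevel 3 0 r) ℚ)) →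
      ((3 ^ e' : ℕ) : ZMod (3 ^ (j + 1))) *
        Λf (galoisCohomology.localization
          (WeierstrassCurve.torsionGaloisModule W' (((3 : ℕ) : ℤ) ^ j * ((3 : ℕ) : ℤ))) (Sum.inr v') 1 κ₀) =
        PadicInt.toZModPow (j + 1) s

/-- Local notation: the UNLOCKED two-exponent port at `(W, v₃, η, P)`, torsion slot `0`, defect exponent `e`
(gen 7 PortRows' `hPort`, VERBATIM). -/
local notation3 (prettyPrint := false) "PORTU₂⟦" W' ", " e' ", " v' ", " η' ", " P' "⟧" =>
  ∀ (k k' : ℕ) (Dk : KolyvaginDatum (WeierstrassCurve.torsionGaloisModule W' (((3 : ℕ) : ℤ) ^ k * ((3 : ℕ) : ℤ))))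
    (Dk' : KolyvaginDatum (WeierstrassCurve.torsionGaloisModule W' (((3 : ℕ) : ℤ) ^ k' * ((3 : ℕ) : ℤ))))
    (red : (WeierstrassCurve.torsionGaloisModule W' (((3 : ℕ) : ℤ) ^ k' * ((3 : ℕ) : ℤ))).toContRepresentation →ⁱL
      (WeierstrassCurve.torsionGaloisModule W' (((3 : ℕ) : ℤ) ^ k * ((3 : ℕ) : ℤ))).toContRepresentation),
    Dk.IsCanonicalTauDatumThreeAtWith W' k k η' → Dk'.IsCanonicalTauDatumThreeAtWith W' k' k' η' → k ≤ k' →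
    (∀ x : geomTorsion W' (((3 : ℕ) : ℤ) ^ k' * ((3 : ℕ) : ℤ)),
      ((red x : geomTorsion W' (((3 : ℕ) : ℤ) ^ k * ((3 : ℕ) : ℤ))) : geomPoints W') =
        (((3 : ℕ) : ℤ) ^ (k' - k)) • (x : geomPoints W')) →
    ∃ κ Λ κ' κu Λu κu',
      KatoKuriharaWitnessAtTwoExp W' k 0 e' Dk v' P' κ Λ κ' ∧
      KatoKuriharaWitnessAtTwoExp W' k' 0 e' Dk' v' P' κu Λu κu' ∧
      ∀ d, Dk'.IsLevel d → Dk.IsLevel d →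
        galoisCohomology.map red 1 (κu d) = κ d ∧ galoisCohomology.map red 1 (κu' d) = κ' d

/-! ### §1 The two-exponent rider at torsion slot `t + 1` for `Λ` is the rider at slot `t` for `3 • Λ` -/

/-- **Slot shift of the two-exponent rider**: RIDER₂ at `(t+1, e)` for `Λ` is EXACTLY RIDER₂ at `(t, e)` for
the `3`-scaled datum `3 • Λ` — the premise reads `3^{t+1}•Λ = 3^t•(3•Λ)`, the conclusion does not mention `Λ`
(gen 8's `katoExpStarFiniteLevelAt_smul` in acc6's two-exponent currency).  At a multiplicative `3` with
`E(ℚ₃)[3] = 0` and `3^v ∥ c₃` the dual-exponential lattice is `3^{v−1}ℤ₃` (Tate curve), so Kato's `Λ` carries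
the rider at `(1, v)`, i.e. `3•Λ` carries it at `(0, v)`. [cite: Kim2022StructureSelmer, §3.2.3 and Lemma 3.3 (arXiv v3 pp. 16–18)] -/
theorem rider₂_smul {W : WeierstrassCurve ℚ} [W.IsElliptic]
    [ContinuousSMul ℤ_[3] (W.tateModule 3)] {j t e : ℕ} {v : HeightOneSpectrum (𝓞 ℚ)}
    {Λ : ∀ (k' : ℕ) (r : Finset (HeightOneSpectrum (𝓞 ℚ))),
      H1 (tateRep W 3) (cycSubgroup 3 k' r) →ₗ[ℤ_[3]] ℚ_[3] ⊗[ℚ] CyclotomicField (cycLevel 3 k' r) ℚ}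
    {Λf : galoisCohomology ((W.torsionGaloisModule (((3 : ℕ) : ℤ) ^ j * ((3 : ℕ) : ℤ))).toLocal
      (Sum.inr v)) 1 →+ ZMod (3 ^ (j + 1))}
    (h : RIDER₂⟦W, j, t + 1, e, v, Λ, Λf⟧) :
    RIDER₂⟦W, j, t, e, v, (fun k' r => ((3 : ℕ) : ℤ_[3]) • Λ k' r), Λf⟧ := by
  intro r Ψ hΨ y κ₀ s hres hloc hval
  refine h r Ψ hΨ y κ₀ s hres hloc ?_
  obtain ⟨l, hl, heq⟩ := hval
  refine ⟨l, hl, ?_⟩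
  rw [← heq, LinearMap.smul_apply, smul_smul, ← pow_succ]

/-! ### §2 ★₂-u UNLOCKED: the bare two-exponent witness clauses at two depths + (COMP), value rows displayed -/

variable (W : WeierstrassCurve ℚ) [W.IsElliptic] [W.IsGloballyMinimal]
  [ContinuousSMul ℤ_[3] (W.tateModule 3)] [Module.Free ℤ_[3] (W.tateModule 3)]
  [Module.Finite ℤ_[3] (W.tateModule 3)]

set_option backward.isDefEq.respectTransparency false in
/-- **★₂-u UNLOCKED** — the bare two-depth two-exponent witness clauses `KatoKuriharaWitnessAtTwoExp W · 0 e · v₃ P`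
+ (COMP), for all `k ≤ k′`, shared-`η` canonical `τ`-data, pinned `red`, from: Kato's witnesses `hbody` for `P.f`
at the conductor level (`hN`), the finite-level functionals `Λfin j` with the (Λ)-clauses `hΛ` and the
two-exponent riders `hfin₂` at `(0, e)`, `hcdA`, THEOREM D-u's certificate `ht0` at `3` only, the per-level VALUE
ROWS `hvalue` (displayed), surj(3) and the place `v₃` — ANY reduction type at `3` (no `Addv`, no `c₃`, no Manin
binder).  Proof text = seat acc3's ★₂-u (`KimAtThreeTwoExponentPortOfZetaBodyU`, p477581) with the locked
predicate's `intro` line removed; the witness pair is acc3's ★★-u on w2-c3's THEOREM D-u.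
[cite: Kato2004Asterisque, (8.1.3) (p. 180), §9.4 (p. 188), Thm. 9.7 (p. 189) and Ex. 13.3 (pp. 224–225)]
[cite: Kim2022StructureSelmer, Thm. 3.13 and §1.2.2, §2.2.2, §3.2.3, §3.3–§3.4.1 (arXiv v3 pp. 12, 16–18, 26–27)]
[cite: MazurRubin2004, Def. 3.1.3, Thm. 3.2.4 and App. A (Lemma A.1, Remark A.5)] [cite: Sakamoto2024, §2 and Def. 4.1] -/
theorem katoKuriharaPortUnlockedTwoExp_zero_of_zetaBody_of_unramified
    {N : ℕ} [NeZero N] (P : ModularParametrizationData W N) (hN : N = W.conductorNorm ℤ)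
    {ι : (n : ℕ) → (CyclotomicField n ℚ →+* ℂ)} {κK : ℝ}
    {Λ : ∀ (k' : ℕ) (r : Finset (HeightOneSpectrum (𝓞 ℚ))),
      H1 (tateRep W 3) (cycSubgroup 3 k' r) →ₗ[ℤ_[3]] ℚ_[3] ⊗[ℚ] CyclotomicField (cycLevel 3 k' r) ℚ}
    {c d a : ℤ} {A : ℕ}
    {z : ∀ (k' : ℕ) (r : (cyclotomicLevelsRat 3 (badPlaces c d A N)).Ideals),
      H1 (tateRep W 3) ((cyclotomicLevelsRat 3 (badPlaces c d A N)).level k' r.1)}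
    {x : ∀ (k' : ℕ) (r : (cyclotomicLevelsRat 3 (badPlaces c d A N)).Ideals),
      CyclotomicField (cycLevel 3 k' r.1) ℚ}
    (hbody : ZetaBody W 3 P.f ι κK Λ c d a A z x)
    {e : ℕ} {v₃ : HeightOneSpectrum (𝓞 ℚ)} (hv₃ : ((3 : ℕ) : 𝓞 ℚ) ∈ v₃.asIdeal)
    (hsurj : W.HasSurjectiveModNGaloisRep ((3 : ℕ) : ℤ))
    (Λfin : ∀ j : ℕ, galoisCohomology ((W.torsionGaloisModule (((3 : ℕ) : ℤ) ^ j * ((3 : ℕ) : ℤ))).toLocal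
      (Sum.inr v₃)) 1 →+ ZMod (3 ^ (j + 1)))
    (hΛ : ∀ j : ℕ,
      (∀ c : ZMod (3 ^ (j + 1)), ∃ x ∈ propagatedSelmerStructure W 3 j (Sum.inr v₃), Λfin j x = c) ∧
      (∀ x ∈ propagatedSelmerStructure W 3 j (Sum.inr v₃),
        Λfin j x = 0 ↔ x ∈ W.kummerSelmerStructure (((3 : ℕ) : ℤ) ^ j * ((3 : ℕ) : ℤ)) (Sum.inr v₃)))
    (hfin₂ : ∀ j : ℕ, RIDER₂⟦W, j, 0, e, v₃, Λ, Λfin j⟧)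
    {η : (q : HeightOneSpectrum (𝓞 ℚ)) → (ZMod (Ideal.absNorm q.asIdeal))ˣ}
    -- the auxiliary datum avoids every prime `≡ 1 (mod 3)` (so every Kolyvagin prime is usable)
    (hcdA : ∀ q : ℕ, q.Prime → q ≡ 1 [MOD 3] → ¬ q ∣ 2 * c.natAbs * d.natAbs * A)
    -- THEOREM D-u's certificate at the place `3` (`t = 0`); NO `hbad`
    (ht0 : ∀ w : HeightOneSpectrum (𝓞 ℚ), ((3 : ℕ) : 𝓞 ℚ) ∈ w.asIdeal →
        ∀ Q : (W.baseChange (w.adicCompletion ℚ)).toAffine.Point, 3 • Q = 0 → Q = 0)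
    -- the per-level VALUE ROWS at torsion slot `0` (T-PK6-VROW's OUT), displayed
    (hvalue : ∀ (j : ℕ) (σ : HeightOneSpectrum (𝓞 ℚ) → absoluteGaloisGroup ℚ),
      (∀ q, σ q ∈ (adicCompletionPrime ℚ q).inertia (absoluteGaloisGroup ℚ)) →
      (∀ q, modNCyclotomicCharacter ℚ (Ideal.absNorm q.asIdeal) (σ q) = η q) →
      ∀ (r : Finset (HeightOneSpectrum (𝓞 ℚ)))
        (hr : ∀ q ∈ r, q ∈ (cyclotomicLevelsRat 3 (badPlaces c d A N)).primes),
        (∀ q ∈ r, Kato.IsKolyvaginPrime W 3 (j + 1) ((primesEquiv q : Nat.Primes) : ℕ)) →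
        (∀ q ∈ r, Subgroup.zpowers (η q) = ⊤) →
        ∃ (s : ℤ_[3]) (u : (ZMod (3 ^ (j + 1)))ˣ)
          (ψ : (ℓ : ℕ) → (ZMod ℓ)ˣ →* Multiplicative (ZMod (3 ^ (j + 1)))),
          (∀ q ∈ r, Function.Surjective (ψ (Ideal.absNorm q.asIdeal))) ∧
          (∃ l ∈ cycIntLattice 3 (cycLevel 3 0 r),
            (((3 : ℕ) : ℤ_[3]) ^ (0 : ℕ)) • ((1 : ℚ_[3]) ⊗ₜ[ℚ]
              ((r.noncommProd 𝐃F⟦r, σ⟧ (ZetaValue.pairwise_commute_fieldDeriv (cycLevel 3 0 r)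
                  (fun ℓ => modNCyclotomicCharacter ℚ (cycLevel 3 0 r) (σ ℓ))
                  (fun ℓ => ((primesEquiv ℓ : Nat.Primes) : ℕ) - 1) r))
                (x 0 ⟨r, hr⟩ + sigma (cycLevel 3 0 r) (-1) (x 0 ⟨r, hr⟩)))) -
              ((s : ℚ_[3]) ⊗ₜ[ℚ] (1 : CyclotomicField (cycLevel 3 0 r) ℚ)) =
            (((3 : ℕ) : ℤ_[3]) ^ (j + 1)) • (l : ℚ_[3] ⊗[ℚ] CyclotomicField (cycLevel 3 0 r) ℚ)) ∧
          haveI : NeZero (∏ q ∈ r, Ideal.absNorm q.asIdeal) :=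
            ⟨Finset.prod_ne_zero_iff.2 fun q _ h => q.ne_bot (Ideal.absNorm_eq_zero_iff.1 h)⟩
          PadicInt.toZModPow (j + 1) s = (u : ZMod (3 ^ (j + 1))) *
            ((3 : ℕ) : ZMod (3 ^ (j + 1))) ^ (0 : ℕ) *
              kuriharaNumber P.f (3 ^ (j + 1)) (∏ q ∈ r, Ideal.absNorm q.asIdeal) ψ) :
    PORTU₂⟦W, e, v₃, η, P⟧ := by
  intro k k' D D' red hDW hDW' hkk' hred
  -- the guards
  obtain ⟨hT, hC, S, τ, hS, hτμ, hτq, hP⟩ := hDW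
  obtain ⟨hT', hC', S', τ', hS', hτμ', hτq', hP'⟩ := hDW'
  have hirr : W.HasIrreducibleModPGaloisRep 3 :=
    hasIrreducibleModPGaloisRep_of_hasSurjectiveModNGaloisRep W 3 hsurj
  -- Kolyvagin primes of the right levels (E1-deep on the deep classes of the guards)
  have hKol : ∀ q ∈ D.primes, Kato.IsKolyvaginPrime W 3 (k + 1) ((primesEquiv q : Nat.Primes) : ℕ) :=
    fun q hq => KolyvaginPrime.isKolyvaginPrime_of_mem_frobeniusClassPrimes_of_le W
      (Nat.le_add_right k 0) (fun v hv => (hS v hv).1) hτμ hτq (hP hq)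
  have hKol' : ∀ q ∈ D'.primes, Kato.IsKolyvaginPrime W 3 (k' + 1) ((primesEquiv q : Nat.Primes) : ℕ) :=
    fun q hq => KolyvaginPrime.isKolyvaginPrime_of_mem_frobeniusClassPrimes_of_le W
      (Nat.le_add_right k' 0) (fun v hv => (hS' v hv).1) hτμ' hτq' (hP' hq)
  -- every Kolyvagin prime is a usable prime of Kato's system for `(c, d, A, N)`
  have husable : ∀ (j : ℕ) (q : HeightOneSpectrum (𝓞 ℚ)),
      Kato.IsKolyvaginPrime W 3 (j + 1) ((primesEquiv q : Nat.Primes) : ℕ) →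
        q ∈ (cyclotomicLevelsRat 3 (badPlaces c d A N)).primes := by
    intro j q hq
    have hℓ := hq.prime
    have h13 : ((primesEquiv q : Nat.Primes) : ℕ) ≡ 1 [MOD 3] :=
      hq.modEq_one.of_dvd (dvd_pow_self 3 (Nat.succ_ne_zero j))
    refine (mem_primes_cyclotomicLevelsRat_badPlaces_iff 3 c d A N q).2 ⟨fun hdvd => ?_, hq.ne⟩
    rcases (Nat.Prime.dvd_mul hℓ).mp hdvd with h | h
    · exact hcdA _ hℓ h13 h
    · apply hq.not_dvd
      rw [← hN]
      exact dvd_mul_of_dvd_left h 3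
  have hPr : D.primes ⊆ (cyclotomicLevelsRat 3 (badPlaces c d A N)).primes :=
    fun q hq => husable k q (hKol q hq)
  have hPr' : D'.primes ⊆ (cyclotomicLevelsRat 3 (badPlaces c d A N)).primes :=
    fun q hq => husable k' q (hKol' q hq)
  -- `𝓕_can,3 = ⊤` at every depth (`t = 0`, Mazur–Rubin Lemma A.1 along the reduction tower)
  have htower : ∀ j : ℕ,
      ∃ redj : (W.torsionGaloisModule (((3 : ℕ) : ℤ) ^ (j + 1) * ((3 : ℕ) : ℤ))).toContRepresentation →ⁱL
          (W.torsionGaloisModule (((3 : ℕ) : ℤ) ^ j * ((3 : ℕ) : ℤ))).toContRepresentation,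
        ∀ y : geomTorsion W (((3 : ℕ) : ℤ) ^ (j + 1) * ((3 : ℕ) : ℤ)),
          ((redj y : geomTorsion W (((3 : ℕ) : ℤ) ^ j * ((3 : ℕ) : ℤ))) : geomPoints W) =
            ((3 : ℕ) : ℤ) • (y : geomPoints W) := by
    intro j
    obtain ⟨redj, hredj⟩ := exists_torsionReduction_three W j (j + 1)
    refine ⟨redj, fun y => ?_⟩
    rw [hredj, Nat.add_sub_cancel_left, pow_one]
  choose redT hredT using htower
  have htop : ∀ (j : ℕ) (w : HeightOneSpectrum (𝓞 ℚ)), ((primesEquiv w : Nat.Primes) : ℕ) = 3 →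
      propagatedSelmerStructure W 3 j (Sum.inr w) = ⊤ := by
    intro j w hw
    have hw3 : ((3 : ℕ) : 𝓞 ℚ) ∈ w.asIdeal := KolyvaginPrime.natCast_mem_asIdeal_of_primesEquiv_eq hw
    exact propagatedSelmerStructure_three_eq_top_of_torsion_eq_zero W w hw3 (ht0 w hw3) redT hredT j
  -- the two-exponent witness package at the two depths + (COMP), value rows from `hvalue` (acc3's ★★-u)
  obtain ⟨κf, κu, h₁, h₂, h₃⟩ :=
    KimAtThreeTwoExponentWitnessPairU.exists_katoKuriharaWitnessAtTwoExp_pair_of_zetaBody_of_unramified W P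
      hbody hirr hkk' red hred hv₃ (hΛ k) (hΛ k') (hfin₂ k) (hfin₂ k') D hT D' hT' hC hC' hPr hPr' hKol hKol'
      (htop k) (htop k')
      (fun σ hI hχ r hr => hvalue k σ hI hχ r (fun q hq => hPr (hr (Finset.mem_coe.2 hq)))
        (fun q hq => hKol q (hr (Finset.mem_coe.2 hq)))
        (fun q hq => hC.zpowers_eq_top (hr (Finset.mem_coe.2 hq))))
      (fun σ hI hχ r hr => hvalue k' σ hI hχ r (fun q hq => hPr' (hr (Finset.mem_coe.2 hq)))
        (fun q hq => hKol' q (hr (Finset.mem_coe.2 hq)))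
        (fun q hq => hC'.zpowers_eq_top (hr (Finset.mem_coe.2 hq))))
  exact ⟨κf, Λfin k, κf, κu, Λfin k', κu, h₁, h₂, fun l hl' hl => ⟨h₃ l hl' hl, h₃ l hl' hl⟩⟩

/-! ### §3 The unlocked two-exponent port on the NON-ADDITIVE non-anomalous rows from `ZetaBody` + certificates -/

set_option backward.isDefEq.respectTransparency false in
/-- **★₂-u unlocked on the NON-ADDITIVE non-anomalous `t = 0` rows — split-multiplicative `3 ∣ c₃` INCLUDED
— value rows DISCHARGED without `9 ∣ N`**: the unlocked two-exponent port at defect exponent `e` from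
`hbody : ZetaBody W 3 P.f …` at the conductor level, R-κ (b) (`hNorm`, `hκ0`), END-m1's level-free guards, the
integer models `aM`, the NON-ANOMALOUS depletion certificate `hE0`/`hE` (`q = 3` factor `4 − a₃` good /
`3 ∓ 1` multiplicative), the 𝔊⁻ certificate `hR0`/`hR`, surj(3), `v₃ ∣ 3`, the (Λ)-clauses `hΛ`, the
two-exponent riders `hfin₂` at `(1, e)` (lattice `3^{e−1}ℤ₃·unit`: `e = 0` at a good non-anomalous /
supersingular / non-split or `3 ∤ c₃` multiplicative `3`, `e = v₃(c₃)` at a split multiplicative `3`),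
`hcdA` and `ht0` — §2 on the `3`-scaled body `zetaBody_smul 3 hbody`, riders by `rider₂_smul`, value rows by
gen 8's `valueRows_of_zetaBody_mul`.  Nothing asserted; nothing booked.
[cite: Kato2004Asterisque, §9.4 (p. 188), Thm. 9.7 (p. 189), §6.2 (p. 161), Thm. 6.6 (1) (p. 163) and Ex. 13.3 (pp. 224–225)]
[cite: Kim2022StructureSelmer, §3.2.3, Lemma 3.3, Thm. 3.13 and §3.3–§3.5 (arXiv v3 pp. 16–18, 26–28)]
[cite: MazurRubin2004, Def. 3.1.3, Thm. 3.2.4 and App. A (Lemma A.1, Remark A.5)] [cite: Sakamoto2024, §2 and Def. 4.1] -/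
theorem katoKuriharaPortUnlockedTwoExp_zero_of_zetaBody_nonAdd_of_unramified
    {N : ℕ} [NeZero N] (P : ModularParametrizationData W N) (hN : N = W.conductorNorm ℤ)
    {ι : (n : ℕ) → (CyclotomicField n ℚ →+* ℂ)} {κK : ℝ}
    {Λ : ∀ (k' : ℕ) (r : Finset (HeightOneSpectrum (𝓞 ℚ))),
      H1 (tateRep W 3) (cycSubgroup 3 k' r) →ₗ[ℤ_[3]] ℚ_[3] ⊗[ℚ] CyclotomicField (cycLevel 3 k' r) ℚ}
    {c d a : ℤ} {A : ℕ} [NeZero A]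
    {z : ∀ (k' : ℕ) (r : (cyclotomicLevelsRat 3 (badPlaces c d A N)).Ideals),
      H1 (tateRep W 3) ((cyclotomicLevelsRat 3 (badPlaces c d A N)).level k' r.1)}
    {x : ∀ (k' : ℕ) (r : (cyclotomicLevelsRat 3 (badPlaces c d A N)).Ideals),
      CyclotomicField (cycLevel 3 k' r.1) ℚ}
    (hbody : ZetaBody W 3 P.f ι κK Λ c d a A z x)
    -- R-κ (b) and END-m1's level-free guards
    (hNorm : ∃ u : ℚ, (u : ℝ) = κK ∧ padicValRat 3 u = 0) (hκ0 : κK ≠ 0)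
    (d' : ℤ) (hcd : Int.gcd (c * d) A = 1) (hdd' : d * d' ≡ 1 [ZMOD (A : ℤ)]) (hAN : Nat.Coprime A N)
    (aM : ℕ → ℤ) (haM : ∀ q ∈ (3 * A).primeFactors, cuspCoeff P.f q = aM q)
    -- the NON-ANOMALOUS depletion certificate (`q = 3` factor: `4 − a₃` good / `3 ∓ 1` multiplicative)
    (hE0 : ∏ q ∈ (3 * A).primeFactors, (1 - (aM q : ℚ) / q + (if q ∣ N then 0 else (1 / q : ℚ))) ≠ 0)
    (hE : padicValRat 3 ((3 : ℚ) *
      ∏ q ∈ (3 * A).primeFactors, (1 - (aM q : ℚ) / q + (if q ∣ N then 0 else (1 / q : ℚ)))) = 0)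
    -- the 𝔊⁻ certificate
    (hR0 : (c : ℚ) ^ 2 * (d : ℚ) ^ 2 * ratMinusSymbol P.f ((a : ℚ) / A) -
        (c : ℚ) * (d : ℚ) ^ 2 * ratMinusSymbol P.f ((a * c : ℚ) / A) -
        (c : ℚ) ^ 2 * (d : ℚ) * ratMinusSymbol P.f ((a * d' : ℚ) / A) +
        (c : ℚ) * (d : ℚ) * ratMinusSymbol P.f ((a * c * d' : ℚ) / A) ≠ 0)
    (hR : padicValRat 3 ((c : ℚ) ^ 2 * (d : ℚ) ^ 2 * ratMinusSymbol P.f ((a : ℚ) / A) -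
        (c : ℚ) * (d : ℚ) ^ 2 * ratMinusSymbol P.f ((a * c : ℚ) / A) -
        (c : ℚ) ^ 2 * (d : ℚ) * ratMinusSymbol P.f ((a * d' : ℚ) / A) +
        (c : ℚ) * (d : ℚ) * ratMinusSymbol P.f ((a * c * d' : ℚ) / A)) = 0)
    {v₃ : HeightOneSpectrum (𝓞 ℚ)} (hv₃ : ((3 : ℕ) : 𝓞 ℚ) ∈ v₃.asIdeal)
    (hsurj : W.HasSurjectiveModNGaloisRep ((3 : ℕ) : ℤ))
    -- the (Λ)-clauses and the two-exponent riders AT `(1, e)`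
    {e : ℕ}
    (Λfin : ∀ j : ℕ, galoisCohomology ((W.torsionGaloisModule (((3 : ℕ) : ℤ) ^ j * ((3 : ℕ) : ℤ))).toLocal
      (Sum.inr v₃)) 1 →+ ZMod (3 ^ (j + 1)))
    (hΛ : ∀ j : ℕ,
      (∀ c : ZMod (3 ^ (j + 1)), ∃ x ∈ propagatedSelmerStructure W 3 j (Sum.inr v₃), Λfin j x = c) ∧
      (∀ x ∈ propagatedSelmerStructure W 3 j (Sum.inr v₃),
        Λfin j x = 0 ↔ x ∈ W.kummerSelmerStructure (((3 : ℕ) : ℤ) ^ j * ((3 : ℕ) : ℤ)) (Sum.inr v₃)))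
    (hfin₂ : ∀ j : ℕ, RIDER₂⟦W, j, 1, e, v₃, Λ, Λfin j⟧)
    {η : (q : HeightOneSpectrum (𝓞 ℚ)) → (ZMod (Ideal.absNorm q.asIdeal))ˣ}
    (hcdA : ∀ q : ℕ, q.Prime → q ≡ 1 [MOD 3] → ¬ q ∣ 2 * c.natAbs * d.natAbs * A)
    -- THEOREM D-u's row certificate at `3` only (`t = 0`); NO `hbad`
    (ht0 : ∀ w : HeightOneSpectrum (𝓞 ℚ), ((3 : ℕ) : 𝓞 ℚ) ∈ w.asIdeal →
        ∀ Q : (W.baseChange (w.adicCompletion ℚ)).toAffine.Point, 3 • Q = 0 → Q = 0) :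
    PORTU₂⟦W, e, v₃, η, P⟧ :=
  katoKuriharaPortUnlockedTwoExp_zero_of_zetaBody_of_unramified W P hN (zetaBody_smul 3 hbody) hv₃ hsurj Λfin
    hΛ (fun j => rider₂_smul (hfin₂ j)) hcdA ht0
    (valueRows_of_zetaBody_mul hbody P.isNewformOf (by decide)
      (hasIrreducibleModPGaloisRep_of_hasSurjectiveModNGaloisRep W 3 hsurj) hNorm hκ0 d' hcd hdd' hAN
      aM haM hE0 hE hR0 hR η)

end Summit.BirchSwinnertonDyer.BirchSwinnertonDyer.Theorems.KimAtThreeShallowEqDeepMultTwoExpPort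

end
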